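import Summits.BirchSwinnertonDyer.BirchSwinnertonDyer.Theorems.CongruentShaFreeCutKatoZetaRoadNontrivialH1
import HarnessLib

set_option linter.dupNamespace false
set_option autoImplicit false

/-! # Route `CongruentShaFreeCut` (rung S2) — crux B `AnalyticRankOneOfRankOneFiniteShaTwo`
# (stmt-BirchSwinnertonDyer-19080): the Kato–zeta road consumes only the ANNIHILATION HALF of Perrin-Riou's
# formula at the additive prime `2` — «Heegner point torsion ⟹ the pinned Kato class of `E_n` has `2`-adic Kummer
# logarithm `0`» (no constant `c`, no embedding `ι : K → ℚ₂`)

Cell `bsd-cn100`, prover seat `bsd-cn100-s2-c3` (g17); the S2 twin of `MordellShaFreeCutKatoZetaRoadLogZero` (seat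
`bsd-cn100-s2b-c3` g22, p528124), written against the S2 road's own compositions. THEOREMS ONLY (0 `def`, 0 new named
fact); supports, does not close, stmt-BirchSwinnertonDyer-19080. PARTITION: none — RANK axis. A DESIGN DATUM for the
registered line `kato-zeta-perrin-riou` v1h (skeleton sha256 21ecf8dd…; stubs `stub_refereedInputs` = RI7′ and
`stub_prFormulaAtTwo : PRFormulaAtTwoH2`); no registry act is asked or implied — re-cuts are the plan's.

## The finding (kernel-checked below)

In the landed S2 compositions `CongruentShaFreeCutKatoZetaRoadPinnedH2.heegnerNonTorsionAtTwo_of_prFormulaH2_of_readings`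
(p465073) and `CongruentShaFreeCutKatoZetaRoadNontrivialH1.heegnerNonTorsionAtTwo_of_prFormulaH2_of_readings_rankOne`
(p516081 — the composition of the REGISTERED v1h body) the research statement `PRFormulaAtTwoH2` — «… `∃ c ≠ 0`,
`log(loc₂ ι[z]) = c · log_ω(P)²` in the Kummer currency `HasLocPKummerLog`» — is consumed through
`obtain ⟨c, hc, hPRx⟩` where `hc : c ≠ 0` is NEVER USED, and only at a TORSION Heegner point `P` (the proof is by
contradiction from `IsOfFinAddOrder P`), where `log_ω(P) = 0` (`AcPConverseLinks.padicLogPoint_formalIndex_smul_eq_zero_of_isOfFinAddOrder`)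
turns it into `HasLocPKummerLog (E_n) 2 pin.katoClass 0`. Hence the road needs only the following statement, displayed
here as the hypothesis schema `hV` (no `def`: naming is the typer's / the plan's if the design is adopted):

  (V₂) for every square-free `n`, every imaginary quadratic `K` with the Heegner hypothesis for `N = N(E_n)` and
  for `2` and with `L(E_n^{(d_K)}, 1) ≠ 0`, every Heegner point `P ∈ E_n(K)` of level `N` which is TORSION, if
  `L(E_n, 1) = 0` then every v2-pinned Kato descent datum `D` of `(E_n, 2)` satisfying Kato's Main Conjecture
  12.10 in `Λ ⊗ ℚ₂` has `HasLocPKummerLog (E_n) 2 pin.katoClass 0` — the localisation at `2` of (a non-zero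
  multiple of) Kato's class is the Kummer class of a point of `E_n(ℚ₂)` of logarithm `0`.

By Gross–Zagier + Kolyvagin over `K` (conjunct 6 of RI7′) and `L(E_n^{(d_K)},1) ≠ 0`, «`P` torsion» is
«`ord_{s=1} L(E_n,s) ≠ 1`», i.e. (with `L(E_n,1) = 0` and the sign forced by the Heegner hypothesis) «`ord ≥ 3`»: (V₂)
is, for the congruent number curves at `p = 2` and in the local Kummer currency, a CONSEQUENCE of the (⟹) half of
Perrin-Riou's Conjecture 3.3.2 («`L(f,s)` a un zéro d'ordre `> 1` en `1` ⟹ the bottom class of the zeta element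
vanishes in `H¹_f`»; stated at primes of good reduction — for arbitrary `(E, p)` the shape is Burungale–Skinner–Tian–Wan's
Conj. 1.12 (a)+(b)) and the reading of Bertolini–Darmon–Venerucci's Thm. A at a torsion `P` («`log_{ω}(res_p ζ^Kato) =
c · log²_{ω}(P)`, `P` of infinite order iff the zero is simple»; printed for SEMISTABLE odd `p` only — `E_n` is ADDITIVE
at `2`). (V₂) is implied by `PRFormulaAtTwoH2` (§1), so it inherits every truth caveat of the registered stub and adds
none. It says nothing at curves of analytic rank one — the non-vanishing half (`c ≠ 0`), which the road never uses: it
gets «`ι[z]` non-torsion with Kummer log `≠ 0`» from (R1)/(R2)/(3.1′)/(3.1″) under the crux hypotheses.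

CONTENTS. §1 `logZeroAtTwo_of_prFormulaH2` — MONOTONICITY `PRFormulaAtTwoH2 → (V₂)` (converse not claimed). §2
`heegnerNonTorsionAtTwo_of_logZero_of_readings_rankOne` — p516081's composition with `hPR` ↦ `hV` (same readings
(R+K) `hRK` under the crux hypotheses, (3.1′) `h31`, (3.1″) `h31b`; no `ι` is chosen). §3
`cruxB_of_logZero_of_readings_rankOne` — crux B by name (p419056). §4 the census keyed to the registered line:
`cruxB_of_refereed_of_nontrivialH1_of_logZero` ((NT) currency, readings from p515014), **`cruxB_of_RI7prime_of_logZero`**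
(RI7′ token for token as registered ∧ (V₂) ⟹ crux B), `cruxB_of_refereed_of_oneLeRank_rankOne_of_logZero` (sharpest,
rank currency at the pins of the curves in question). The registered road FACTORS through (V₂):
`cruxB_of_RI7prime_of_logZero RI (logZeroAtTwo_of_prFormulaH2 hPR)` has, term for term, the type of
`…NontrivialH1.cruxB_of_RI7prime_of_prFormulaH2 RI hPR` (p524766; seat probe by `rfl`, not re-declared — `dedup.landed`).
NUMBERS: crux B ⟸ 7 citation-borne facts (RI7′) + ONE research statement (V₂) that is implied by the registered one
and drops from it the constant `c ≠ 0` and the datum `ι`; 0 sorry; standard axioms.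

HONEST FRAMING. (V₂) is OPEN exactly like `PRFormulaAtTwoH2` (0 sources at an additive prime: BDV22 Thm. A needs
semistable `p`, BSTW24 Thm. 1.13 needs `p ∤ 2N`; Alpöge–Bhargava–Shnidman §2 after Thm. 2.10 record the gap); this
file does not make it more provable, it only shows that the weaker half suffices and is all the line uses. Nothing
about (V₂), `PRFormulaAtTwoH2`, the seven citation-borne inputs, crux B, the leaf `rankOne_twoConverse_congruentNumber`,
the congruent number problem or any case of BSD is proved here; BSD is not proved by any of this. Build rule (H):
concludes the route decl BY NAME through the S2 cone (`…NontrivialH1` → `…PinnedH2` → `…OfHeegnerNonTorsion`).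
References: [PerrinRiou1993AIF] §3.3, Prop. 3.3.1, Conj. 3.3.2, Formule 3.3.4 (pp. 975–977); [BertoliniDarmonVenerucci2022]
Thm. A (1)–(2); [BurungaleSkinnerTianWan2024] Conj. 1.12, Thm. 1.13; [AlpogeBhargavaShnidman2022] App. A Thm. 10.8 (a),
§10.1.3 (pp. 33–34), §2 after Thm. 2.10; [Kato2004Asterisque] §12.2 (12.2.2) (p. 220), Conj. 12.10 (p. 224), §14.14,
Cor. 14.3; [BurungaleTian2026] Thm. 3.1; [GrossZagier1986] Thm. I.6.3.
-/

noncomputable section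

open scoped Classical

open WeierstrassCurve NumberField IsDedekindDomain Field Literature.NumberTheory.EllipticCurves
  Literature.NumberTheory.EllipticCurves.Rank1Residual Literature.NumberTheory.EllipticCurves.Kato2004
  Literature.NumberTheory.EllipticCurves.Kato2004.EulerSystemValues Literature.NumberTheory.EllipticCurves.Castella2018
  Literature.NumberTheory.GaloisRepresentations Summit.BirchSwinnertonDyer.Rank1Residual.Additive
  Summit.BirchSwinnertonDyer.BirchSwinnertonDyer.Theses.CongruentShaFreeCut
  Summit.BirchSwinnertonDyer.BirchSwinnertonDyer.Theorems.CongruentShaFreeCutKatoDescentDatumOfH2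
  Summit.BirchSwinnertonDyer.BirchSwinnertonDyer.Theorems.CongruentShaFreeCutKatoZetaRoadPinnedH2
  Summit.BirchSwinnertonDyer.BirchSwinnertonDyer.Theorems.CongruentShaFreeCutKatoReadingsOfNontrivialH1
open Summit.BirchSwinnertonDyer.BirchSwinnertonDyer.Theorems.CongruentShaFreeCutOfHeegnerNonTorsion
  (HeegnerNonTorsionAtTwo analyticRankOne_of_facts_of_heegnerNonTorsion)
open Summit.BirchSwinnertonDyer.BirchSwinnertonDyer.Theorems.CongruentShaFreeCutKatoZetaRoadNontrivialH1
  (reading31_of_nontrivial_rankOne)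
open Summit.BirchSwinnertonDyer.BirchSwinnertonDyer.Theorems.CongruentShaFreeCutKatoReading31b (reading31b_two_of_fact)

namespace Summit.BirchSwinnertonDyer.BirchSwinnertonDyer.Theorems.CongruentShaFreeCutKatoZetaRoadLogZero

/-! ## §1 Monotonicity: the registered research statement implies its annihilation half (V₂) -/

/-- **`PRFormulaAtTwoH2 ⟹ (V₂)`** (ACT-TEST-(i)-type certificate: the registered stub implies the weaker statement).
At a TORSION Heegner point `P`, read `P` through the embedding `ι : K → ℚ₂` at a degree-one prime over `2` (Heegner
hypothesis for `2`; `Rank1Residual.X11b.embAt`); Perrin-Riou's formula gives `HasLocPKummerLog (E_n) 2 pin.katoClass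
(c · log_ω(P)²)`, and `log_ω(P) = 0` (`AcPConverseLinks.padicLogPoint_formalIndex_smul_eq_zero_of_isOfFinAddOrder`).
The constant `c` and `c ≠ 0` are not used; the converse is not claimed. [cite: PerrinRiou1993AIF, §3.3, Conj. 3.3.2 and Formule 3.3.4 (pp. 976–977)]
[cite: BertoliniDarmonVenerucci2022, Thm. A (1)–(2)] [cite: AlpogeBhargavaShnidman2022, App. A Thm. 10.8 (a) (p. 33)] -/
theorem logZeroAtTwo_of_prFormulaH2 (hPR : PRFormulaAtTwoH2) :
    ∀ ⦃n : ℕ⦄, Squarefree n →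
      ∀ [(congruentNumberCurve n).IsElliptic] [(congruentNumberCurve n).IsGloballyMinimal]
        [ContinuousSMul ℤ_[2] ((congruentNumberCurve n).tateModule 2)]
        (K : Type) [Field K] [NumberField K] (N : ℕ) [NeZero N],
        (congruentNumberCurve n).conductorNorm ℤ = N → IsImaginaryQuadratic K →
          SatisfiesHeegnerHypothesis N K → SatisfiesHeegnerHypothesis 2 K →
            ((congruentNumberCurve n).quadraticTwist (NumberField.discr K : ℚ)).entireLFunction 1 ≠ 0 →
        ∀ (P : ((congruentNumberCurve n).baseChange K).toAffine.Point),
          IsHeegnerPoint N (congruentNumberCurve n) K P → IsOfFinAddOrder P →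
            (congruentNumberCurve n).entireLFunction 1 = 0 →
        ∀ (D : KatoDescentDatum 2) (pin : KatoDescentDatumPinH2 (congruentNumberCurve n) 2 D),
          (∃ a b : ℕ,
            Ideal.span {((2 : ℕ) : IwasawaAlgebra 2) ^ a} * Module.charIdeal (IwasawaAlgebra 2) D.H2 =
              Ideal.span {((2 : ℕ) : IwasawaAlgebra 2) ^ b} *
                Module.charIdeal (IwasawaAlgebra 2) (D.H ⧸ (IwasawaAlgebra 2) ∙ D.z)) →
          HasLocPKummerLog (congruentNumberCurve n) 2 pin.katoClass 0 := by
  intro n hsq _ _ _ K _ _ N _ hN hK hHN hH2 hLK P hP hPtor hL D pin hMC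
  -- an embedding `ι : K → ℚ₂` at a degree-one prime over `2` (`2` splits in `K`)
  obtain ⟨-, -, 𝔭, -, -, h𝔭, he, hf⟩ :=
    Summit.BirchSwinnertonDyer.Rank1Residual.X11b.exists_anticyclotomic_generator_degreeOnePrime 2 K hK hH2
  set ι : K →+* ℚ_[2] := Summit.BirchSwinnertonDyer.Rank1Residual.X11b.embAt K 2 𝔭 h𝔭 he hf with hιdef
  -- Perrin-Riou's formula at `ι`, `P`, and the pinned datum; the constant and `c ≠ 0` are discarded
  obtain ⟨c, -, hPRx⟩ := hPR hsq K N hN hK hHN hH2 hLK ι P hP hL D pin hMC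
  -- a torsion point has `log_ω(P) = 0`
  have hlog : padicLogOmega (congruentNumberCurve n) 2 ι P = 0 := by
    unfold padicLogOmega
    rw [AcPConverseLinks.padicLogPoint_formalIndex_smul_eq_zero_of_isOfFinAddOrder
      (congruentNumberCurve n) 2 ι hPtor, zero_div]
  rwa [hlog, zero_pow two_ne_zero, mul_zero] at hPRx

/-! ## §2 The pinned-road composition with (V₂) in place of `PRFormulaAtTwoH2` -/

/-- **Heegner points of `E_n` are non-torsion at a rank-one `Ш[2^∞]`-finite datum, from the pinned readings and the
annihilation half (V₂).** Same conclusion and displayed readings as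
`CongruentShaFreeCutKatoZetaRoadNontrivialH1.heegnerNonTorsionAtTwo_of_prFormulaH2_of_readings_rankOne` (p516081) —
`hKato`, (R+K) `hRK` under the crux hypotheses, (3.1′) `h31`, (3.1″) `h31b` — with `hPR : PRFormulaAtTwoH2` replaced by
the schema `hV` = (V₂). Proof ([ABS] §10.1.3 with one step fewer): rank `1` ⟹ `L(E_n,1) = 0` (Kato Cor. 14.3); the
pinned datum with (K); (K) + (3.1′) ⟹ `ι[z]` not `ℤ₂`-torsion (`KatoZeta.forall_pow_smul_iota_zeta_ne_zero`,
Burungale–Tian Thm. 3.1); if `P` were torsion, (V₂) would give Kummer logarithm `0`, contradicting (3.1″). No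
embedding `K → ℚ₂` is chosen. CONDITIONAL on the displayed hypotheses; credits nothing.
[cite: AlpogeBhargavaShnidman2022, App. A Thm. 10.1, Thm. 10.6, §10.1.3 (pp. 33–34)] [cite: BurungaleTian2026, Thm. 3.1]
[cite: Kato2004Asterisque, Conj. 12.10, §14.14, Cor. 14.3] [cite: PerrinRiou1993AIF, §3.3, Conj. 3.3.2] -/
theorem heegnerNonTorsionAtTwo_of_logZero_of_readings_rankOne
    (hKato : ∀ (W : WeierstrassCurve ℚ) [W.IsElliptic] (p : ℕ) [Fact p.Prime],
      kato_finite_of_L_one_ne_zero W p)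
    (hRK : ∀ ⦃n : ℕ⦄, Squarefree n →
      ∀ [(congruentNumberCurve n).IsElliptic] [(congruentNumberCurve n).IsGloballyMinimal]
        [ContinuousSMul ℤ_[2] ((congruentNumberCurve n).tateModule 2)],
        (congruentNumberCurve n).mordellWeilRank = 1 →
          Finite (AddCommGroup.primaryComponent (congruentNumberCurve n).sha 2) →
        ∃ D : KatoDescentDatum 2, Nonempty (KatoDescentDatumPinH2 (congruentNumberCurve n) 2 D) ∧
          ∃ a b : ℕ,
            Ideal.span {((2 : ℕ) : IwasawaAlgebra 2) ^ a} * Module.charIdeal (IwasawaAlgebra 2) D.H2 =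
              Ideal.span {((2 : ℕ) : IwasawaAlgebra 2) ^ b} *
                Module.charIdeal (IwasawaAlgebra 2) (D.H ⧸ (IwasawaAlgebra 2) ∙ D.z))
    (h31 : ∀ ⦃n : ℕ⦄, Squarefree n →
      ∀ [(congruentNumberCurve n).IsElliptic] [(congruentNumberCurve n).IsGloballyMinimal]
        [ContinuousSMul ℤ_[2] ((congruentNumberCurve n).tateModule 2)]
        (D : KatoDescentDatum 2), Nonempty (KatoDescentDatumPinH2 (congruentNumberCurve n) 2 D) →
        (congruentNumberCurve n).mordellWeilRank = 1 →
          Finite (AddCommGroup.primaryComponent (congruentNumberCurve n).sha 2) →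
            Finite (IwasawaAlgebra.coinvariants 2 D.H2))
    (h31b : ∀ ⦃n : ℕ⦄, Squarefree n →
      ∀ [(congruentNumberCurve n).IsElliptic] [(congruentNumberCurve n).IsGloballyMinimal]
        [ContinuousSMul ℤ_[2] ((congruentNumberCurve n).tateModule 2)]
        (D : KatoDescentDatum 2) (pin : KatoDescentDatumPinH2 (congruentNumberCurve n) 2 D),
        (congruentNumberCurve n).mordellWeilRank = 1 →
          Finite (AddCommGroup.primaryComponent (congruentNumberCurve n).sha 2) →
            (∀ m : ℕ, 2 ^ m • D.ι (Submodule.Quotient.mk D.z) ≠ 0) →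
              ∀ t : ℚ_[2], HasLocPKummerLog (congruentNumberCurve n) 2 pin.katoClass t → t ≠ 0)
    (hV : ∀ ⦃n : ℕ⦄, Squarefree n →
      ∀ [(congruentNumberCurve n).IsElliptic] [(congruentNumberCurve n).IsGloballyMinimal]
        [ContinuousSMul ℤ_[2] ((congruentNumberCurve n).tateModule 2)]
        (K : Type) [Field K] [NumberField K] (N : ℕ) [NeZero N],
        (congruentNumberCurve n).conductorNorm ℤ = N → IsImaginaryQuadratic K →
          SatisfiesHeegnerHypothesis N K → SatisfiesHeegnerHypothesis 2 K →
            ((congruentNumberCurve n).quadraticTwist (NumberField.discr K : ℚ)).entireLFunction 1 ≠ 0 →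
        ∀ (P : ((congruentNumberCurve n).baseChange K).toAffine.Point),
          IsHeegnerPoint N (congruentNumberCurve n) K P → IsOfFinAddOrder P →
            (congruentNumberCurve n).entireLFunction 1 = 0 →
        ∀ (D : KatoDescentDatum 2) (pin : KatoDescentDatumPinH2 (congruentNumberCurve n) 2 D),
          (∃ a b : ℕ,
            Ideal.span {((2 : ℕ) : IwasawaAlgebra 2) ^ a} * Module.charIdeal (IwasawaAlgebra 2) D.H2 =
              Ideal.span {((2 : ℕ) : IwasawaAlgebra 2) ^ b} *
                Module.charIdeal (IwasawaAlgebra 2) (D.H ⧸ (IwasawaAlgebra 2) ∙ D.z)) →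
          HasLocPKummerLog (congruentNumberCurve n) 2 pin.katoClass 0) :
    HeegnerNonTorsionAtTwo := by
  intro n hsq K _ _ N _ hN hK hHN hH2 hLK hrank hsha P hP hPtor
  haveI := isElliptic_congruentNumberCurve hsq.ne_zero
  haveI := isGloballyMinimal_congruentNumberCurve hsq
  haveI : ContinuousSMul ℤ_[2] ((congruentNumberCurve n).tateModule 2) :=
    TateModule.continuousSMul_padicInt
  -- rank one ⟹ `L(E_n, 1) = 0` (Kato's finiteness theorem)
  have hL : (congruentNumberCurve n).entireLFunction 1 = 0 :=
    CongruentShaFreeCutKatoZetaRoad.entireLFunction_one_eq_zero_of_mordellWeilRank_eq_one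
      (congruentNumberCurve n) 2 (hKato _ 2) hrank
  -- the pinned datum with the char-ideal relation (asked under the crux hypotheses); `ι[z]` is not `ℤ₂`-torsion
  obtain ⟨D, ⟨pin⟩, hMC⟩ := hRK hsq hrank hsha
  have hz : ∀ m : ℕ, 2 ^ m • D.ι (Submodule.Quotient.mk D.z) ≠ 0 :=
    KatoZeta.forall_pow_smul_iota_zeta_ne_zero D hMC (h31 hsq D ⟨pin⟩ hrank hsha)
  -- (V₂) at the torsion Heegner point: the pinned Kato class has Kummer logarithm `0` — contradicting (3.1″)
  exact h31b hsq D pin hrank hsha hz 0 (hV hsq K N hN hK hHN hH2 hLK P hP hPtor hL D pin hMC) rfl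

/-! ## §3 Crux B by name from the pinned readings and (V₂) -/

/-- **Crux B `AnalyticRankOneOfRankOneFiniteShaTwo` (stmt-BirchSwinnertonDyer-19080) on the v2-PINNED Kato–zeta road
with the research input weakened to (V₂).** Displayed hypotheses: the six refereed facts of the line of record, the
three print readings (R+K) `hRK` (under the crux hypotheses), (3.1′) `h31`, (3.1″) `h31b`, and ONE research statement
`hV` = (V₂). Proof: `CongruentShaFreeCutOfHeegnerNonTorsion.analyticRankOne_of_facts_of_heegnerNonTorsion` (p419056) ∘ §2.
CONDITIONAL; closes nothing. [cite: AlpogeBhargavaShnidman2022, App. A Thm. 10.1, Thm. 10.6, §10.1.3]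
[cite: GrossZagier1986, Thm. I.6.3 with V.§2] [cite: Kato2004Asterisque, Cor. 14.3, §14.14] [cite: PerrinRiou1993AIF, §3.3, Conj. 3.3.2] -/
theorem cruxB_of_logZero_of_readings_rankOne
    (hpar : ∀ (W : WeierstrassCurve ℚ) [W.IsElliptic] (p : ℕ) [Fact p.Prime], p_parity W p)
    (hmod : ModularForms.exists_isNewformOf) (hHL : HoffsteinLuo1997_exists_twist_L_one_ne_zero)
    (hKato : ∀ (W : WeierstrassCurve ℚ) [W.IsElliptic] (p : ℕ) [Fact p.Prime],
      kato_finite_of_L_one_ne_zero W p)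
    (hHP : ∀ (W : WeierstrassCurve ℚ) (K : Type) [Field K] [NumberField K],
      exists_isHeegnerPoint W K)
    (hGZ : ∀ (W : WeierstrassCurve ℚ) (N : ℕ) [NeZero N] (K : Type) [Field K] [NumberField K],
      analyticRankEK_eq_one_iff_heegner_nonTorsion W N K)
    (hRK : ∀ ⦃n : ℕ⦄, Squarefree n →
      ∀ [(congruentNumberCurve n).IsElliptic] [(congruentNumberCurve n).IsGloballyMinimal]
        [ContinuousSMul ℤ_[2] ((congruentNumberCurve n).tateModule 2)],
        (congruentNumberCurve n).mordellWeilRank = 1 →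
          Finite (AddCommGroup.primaryComponent (congruentNumberCurve n).sha 2) →
        ∃ D : KatoDescentDatum 2, Nonempty (KatoDescentDatumPinH2 (congruentNumberCurve n) 2 D) ∧
          ∃ a b : ℕ,
            Ideal.span {((2 : ℕ) : IwasawaAlgebra 2) ^ a} * Module.charIdeal (IwasawaAlgebra 2) D.H2 =
              Ideal.span {((2 : ℕ) : IwasawaAlgebra 2) ^ b} *
                Module.charIdeal (IwasawaAlgebra 2) (D.H ⧸ (IwasawaAlgebra 2) ∙ D.z))
    (h31 : ∀ ⦃n : ℕ⦄, Squarefree n →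
      ∀ [(congruentNumberCurve n).IsElliptic] [(congruentNumberCurve n).IsGloballyMinimal]
        [ContinuousSMul ℤ_[2] ((congruentNumberCurve n).tateModule 2)]
        (D : KatoDescentDatum 2), Nonempty (KatoDescentDatumPinH2 (congruentNumberCurve n) 2 D) →
        (congruentNumberCurve n).mordellWeilRank = 1 →
          Finite (AddCommGroup.primaryComponent (congruentNumberCurve n).sha 2) →
            Finite (IwasawaAlgebra.coinvariants 2 D.H2))
    (h31b : ∀ ⦃n : ℕ⦄, Squarefree n →
      ∀ [(congruentNumberCurve n).IsElliptic] [(congruentNumberCurve n).IsGloballyMinimal]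
        [ContinuousSMul ℤ_[2] ((congruentNumberCurve n).tateModule 2)]
        (D : KatoDescentDatum 2) (pin : KatoDescentDatumPinH2 (congruentNumberCurve n) 2 D),
        (congruentNumberCurve n).mordellWeilRank = 1 →
          Finite (AddCommGroup.primaryComponent (congruentNumberCurve n).sha 2) →
            (∀ m : ℕ, 2 ^ m • D.ι (Submodule.Quotient.mk D.z) ≠ 0) →
              ∀ t : ℚ_[2], HasLocPKummerLog (congruentNumberCurve n) 2 pin.katoClass t → t ≠ 0)
    (hV : ∀ ⦃n : ℕ⦄, Squarefree n →
      ∀ [(congruentNumberCurve n).IsElliptic] [(congruentNumberCurve n).IsGloballyMinimal]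
        [ContinuousSMul ℤ_[2] ((congruentNumberCurve n).tateModule 2)]
        (K : Type) [Field K] [NumberField K] (N : ℕ) [NeZero N],
        (congruentNumberCurve n).conductorNorm ℤ = N → IsImaginaryQuadratic K →
          SatisfiesHeegnerHypothesis N K → SatisfiesHeegnerHypothesis 2 K →
            ((congruentNumberCurve n).quadraticTwist (NumberField.discr K : ℚ)).entireLFunction 1 ≠ 0 →
        ∀ (P : ((congruentNumberCurve n).baseChange K).toAffine.Point),
          IsHeegnerPoint N (congruentNumberCurve n) K P → IsOfFinAddOrder P →
            (congruentNumberCurve n).entireLFunction 1 = 0 →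
        ∀ (D : KatoDescentDatum 2) (pin : KatoDescentDatumPinH2 (congruentNumberCurve n) 2 D),
          (∃ a b : ℕ,
            Ideal.span {((2 : ℕ) : IwasawaAlgebra 2) ^ a} * Module.charIdeal (IwasawaAlgebra 2) D.H2 =
              Ideal.span {((2 : ℕ) : IwasawaAlgebra 2) ^ b} *
                Module.charIdeal (IwasawaAlgebra 2) (D.H ⧸ (IwasawaAlgebra 2) ∙ D.z)) →
          HasLocPKummerLog (congruentNumberCurve n) 2 pin.katoClass 0) :
    AnalyticRankOneOfRankOneFiniteShaTwo :=
  analyticRankOne_of_facts_of_heegnerNonTorsion hpar hmod hHL hKato hHP hGZ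
    (heegnerNonTorsionAtTwo_of_logZero_of_readings_rankOne hKato hRK h31 h31b hV)

/-! ## §4 The census keyed to the registered line: crux B ⟸ RI7′ ∧ (V₂) -/

/-- **CRUX B ⟸ SIX REFEREED THEOREMS ∧ (NT) ∧ (V₂).** §3 with the three readings fed from the ONE displayed Kato input
(NT) «`𝐇¹_Γ(T_pW) ≠ 0` at every cyclotomic pin» (the Euler-system-free inequality half `1 ≤ rank_Λ 𝐇¹` of Kato's
Euler–Poincaré identity (12.2.2) — Tate 1966 / Perrin-Riou 1995; Greenberg LNM 1716 §4 at `p = 2` — = the LOWER bound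
in Thm. 12.4 (2); zeta elements / Rohrlich enter Thm. 12.4 (1) = the UPPER bound, REPLACED on this road by the tree
theorems (R1)/(R2) under the crux hypotheses) by `readingRK_congruentNumberCurve_of_nontrivial` /
`reading31_of_nontrivial` (p515014) and (3.1″) by `reading31b_two_of_fact Kato2004.locP_kernel_isTorsion_of_rankOne_holds`
— the proof of `…NontrivialH1.cruxB_of_refereed_of_nontrivialH1_of_prFormulaH2` with `hPR` ↦ `hV`. CONDITIONAL.
[cite: Kato2004Asterisque, §12.2 (12.2.2) (p. 220), Thm. 12.4 (2) (p. 221), §14.14 (14.14.1) (p. 243), Cor. 14.3]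
[cite: AlpogeBhargavaShnidman2022, App. A Thm. 10.1, Thm. 10.6, §10.1.3 (pp. 33–34)] [cite: PerrinRiou1993AIF, §3.3, Conj. 3.3.2] -/
theorem cruxB_of_refereed_of_nontrivialH1_of_logZero
    (hpar : ∀ (W : WeierstrassCurve ℚ) [W.IsElliptic] (p : ℕ) [Fact p.Prime], p_parity W p)
    (hmod : ModularForms.exists_isNewformOf) (hHL : HoffsteinLuo1997_exists_twist_L_one_ne_zero)
    (hKato : ∀ (W : WeierstrassCurve ℚ) [W.IsElliptic] (p : ℕ) [Fact p.Prime],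
      kato_finite_of_L_one_ne_zero W p)
    (hHP : ∀ (W : WeierstrassCurve ℚ) (K : Type) [Field K] [NumberField K],
      exists_isHeegnerPoint W K)
    (hGZ : ∀ (W : WeierstrassCurve ℚ) (N : ℕ) [NeZero N] (K : Type) [Field K] [NumberField K],
      analyticRankEK_eq_one_iff_heegner_nonTorsion W N K)
    (hNT : ∀ (W : WeierstrassCurve ℚ) [W.IsElliptic] (p : ℕ) [Fact p.Prime]
      [ContinuousSMul ℤ_[p] (W.tateModule p)] (κ : ZpExtension ℚ p) (γ : absoluteGaloisGroup ℚ),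
      κ.IsCyclotomic → κ.IsTopGenerator γ → ∀ I : IwasawaH1Data W p κ γ, Nontrivial I.H)
    (hV : ∀ ⦃n : ℕ⦄, Squarefree n →
      ∀ [(congruentNumberCurve n).IsElliptic] [(congruentNumberCurve n).IsGloballyMinimal]
        [ContinuousSMul ℤ_[2] ((congruentNumberCurve n).tateModule 2)]
        (K : Type) [Field K] [NumberField K] (N : ℕ) [NeZero N],
        (congruentNumberCurve n).conductorNorm ℤ = N → IsImaginaryQuadratic K →
          SatisfiesHeegnerHypothesis N K → SatisfiesHeegnerHypothesis 2 K →
            ((congruentNumberCurve n).quadraticTwist (NumberField.discr K : ℚ)).entireLFunction 1 ≠ 0 →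
        ∀ (P : ((congruentNumberCurve n).baseChange K).toAffine.Point),
          IsHeegnerPoint N (congruentNumberCurve n) K P → IsOfFinAddOrder P →
            (congruentNumberCurve n).entireLFunction 1 = 0 →
        ∀ (D : KatoDescentDatum 2) (pin : KatoDescentDatumPinH2 (congruentNumberCurve n) 2 D),
          (∃ a b : ℕ,
            Ideal.span {((2 : ℕ) : IwasawaAlgebra 2) ^ a} * Module.charIdeal (IwasawaAlgebra 2) D.H2 =
              Ideal.span {((2 : ℕ) : IwasawaAlgebra 2) ^ b} *
                Module.charIdeal (IwasawaAlgebra 2) (D.H ⧸ (IwasawaAlgebra 2) ∙ D.z)) →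
          HasLocPKummerLog (congruentNumberCurve n) 2 pin.katoClass 0) :
    AnalyticRankOneOfRankOneFiniteShaTwo :=
  cruxB_of_logZero_of_readings_rankOne hpar hmod hHL hKato hHP hGZ
    (readingRK_congruentNumberCurve_of_nontrivial hNT) (reading31_of_nontrivial hNT)
    (reading31b_two_of_fact locP_kernel_isTorsion_of_rankOne_holds) hV

/-- **Crux B from the BUNDLED, REGISTERED RI7′ and the annihilation half (V₂).** `RI` is, token for token, the
registered signature of `stub_refereedInputs` on stmt-BirchSwinnertonDyer-19080 (six refereed theorems — 2-parity,
modularity, Hoffstein–Luo, Kato's finiteness theorem, Heegner points over `K`, Gross–Zagier + Kolyvagin — ∧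
`Kato2004.one_le_rank_iwasawaH1`); `hV` is (V₂). Since `cruxB_of_RI7prime_of_logZero RI (logZeroAtTwo_of_prFormulaH2 hPR)`
has exactly the type of `…NontrivialH1.cruxB_of_RI7prime_of_prFormulaH2 RI hPR` (p524766), this records: the registered
line's research stub may be WEAKENED from `PRFormulaAtTwoH2` to (V₂) with the same citation-borne stub and composition
idea (a design datum; no registry act implied). CONDITIONAL; closes nothing; nothing about RI7′ or (V₂) is proved here.
[cite: Kato2004Asterisque, §12.2 (12.2.2) (p. 220), Cor. 14.3] [cite: DokchitserDokchitserAnnals2010, Thm. 1.4]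
[cite: GrossZagier1986, Thm. I.6.3 with V.§2] [cite: PerrinRiou1993AIF, §3.3, Conj. 3.3.2] -/
theorem cruxB_of_RI7prime_of_logZero
    (RI : (∀ (W : WeierstrassCurve ℚ) [W.IsElliptic] (p : ℕ) [Fact p.Prime], p_parity W p) ∧
      ModularForms.exists_isNewformOf ∧
      HoffsteinLuo1997_exists_twist_L_one_ne_zero ∧
      (∀ (W : WeierstrassCurve ℚ) [W.IsElliptic] (p : ℕ) [Fact p.Prime],
        kato_finite_of_L_one_ne_zero W p) ∧
      (∀ (W : WeierstrassCurve ℚ) (K : Type) [Field K] [NumberField K], exists_isHeegnerPoint W K) ∧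
      (∀ (W : WeierstrassCurve ℚ) (N : ℕ) [NeZero N] (K : Type) [Field K] [NumberField K],
        analyticRankEK_eq_one_iff_heegner_nonTorsion W N K) ∧
      one_le_rank_iwasawaH1)
    (hV : ∀ ⦃n : ℕ⦄, Squarefree n →
      ∀ [(congruentNumberCurve n).IsElliptic] [(congruentNumberCurve n).IsGloballyMinimal]
        [ContinuousSMul ℤ_[2] ((congruentNumberCurve n).tateModule 2)]
        (K : Type) [Field K] [NumberField K] (N : ℕ) [NeZero N],
        (congruentNumberCurve n).conductorNorm ℤ = N → IsImaginaryQuadratic K →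
          SatisfiesHeegnerHypothesis N K → SatisfiesHeegnerHypothesis 2 K →
            ((congruentNumberCurve n).quadraticTwist (NumberField.discr K : ℚ)).entireLFunction 1 ≠ 0 →
        ∀ (P : ((congruentNumberCurve n).baseChange K).toAffine.Point),
          IsHeegnerPoint N (congruentNumberCurve n) K P → IsOfFinAddOrder P →
            (congruentNumberCurve n).entireLFunction 1 = 0 →
        ∀ (D : KatoDescentDatum 2) (pin : KatoDescentDatumPinH2 (congruentNumberCurve n) 2 D),
          (∃ a b : ℕ,
            Ideal.span {((2 : ℕ) : IwasawaAlgebra 2) ^ a} * Module.charIdeal (IwasawaAlgebra 2) D.H2 =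
              Ideal.span {((2 : ℕ) : IwasawaAlgebra 2) ^ b} *
                Module.charIdeal (IwasawaAlgebra 2) (D.H ⧸ (IwasawaAlgebra 2) ∙ D.z)) →
          HasLocPKummerLog (congruentNumberCurve n) 2 pin.katoClass 0) :
    AnalyticRankOneOfRankOneFiniteShaTwo :=
  cruxB_of_refereed_of_nontrivialH1_of_logZero RI.1 RI.2.1 RI.2.2.1 RI.2.2.2.1 RI.2.2.2.2.1 RI.2.2.2.2.2.1
    (nontrivial_of_one_le_rank_iwasawaH1 RI.2.2.2.2.2.2) hV

/-- **CENSUS, SHARPEST FORM, rank currency.** Crux B ⟸ the six refereed theorems ∧ «for every square-free `n` with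
`rank E_n(ℚ) = 1` and `#Ш(E_n)[2^∞] < ∞`, `1 ≤ rank_Λ 𝐇¹_Γ(T₂E_n)` at the cyclotomic `ℤ₂`-pins» ∧ (V₂) — the named
fact `Kato2004.one_le_rank_iwasawaH1` asked only where the road consumes it (the rank and `Nontrivial` currencies
agree pin by pin, `Kato2004.nontrivial_iwasawaH1_iff_one_le_rank`, p517993; readings by
`readingRK_congruentNumberCurve_of_nontrivial_rankOne`, p515014, and `…NontrivialH1.reading31_of_nontrivial_rankOne`,
p516081) = `…NontrivialH1.cruxB_of_refereed_of_oneLeRank_rankOne_of_prFormulaH2` with `hPR` ↦ `hV`: on this road the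
research content of stmt-BirchSwinnertonDyer-19080 modulo the six refereed theorems is ONE Euler-system-free inequality
at the pins of the curves in question + ONE annihilation statement (V₂). CONDITIONAL; closes nothing.
[cite: Kato2004Asterisque, §12.2 (12.2.2) (p. 220), Thm. 12.4 (2) (p. 221), §14.14 (p. 243)]
[cite: AlpogeBhargavaShnidman2022, App. A Thm. 10.1, §10.1.3 (pp. 33–34)] [cite: PerrinRiou1993AIF, §3.3, Conj. 3.3.2] -/
theorem cruxB_of_refereed_of_oneLeRank_rankOne_of_logZero
    (hpar : ∀ (W : WeierstrassCurve ℚ) [W.IsElliptic] (p : ℕ) [Fact p.Prime], p_parity W p)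
    (hmod : ModularForms.exists_isNewformOf) (hHL : HoffsteinLuo1997_exists_twist_L_one_ne_zero)
    (hKato : ∀ (W : WeierstrassCurve ℚ) [W.IsElliptic] (p : ℕ) [Fact p.Prime],
      kato_finite_of_L_one_ne_zero W p)
    (hHP : ∀ (W : WeierstrassCurve ℚ) (K : Type) [Field K] [NumberField K],
      exists_isHeegnerPoint W K)
    (hGZ : ∀ (W : WeierstrassCurve ℚ) (N : ℕ) [NeZero N] (K : Type) [Field K] [NumberField K],
      analyticRankEK_eq_one_iff_heegner_nonTorsion W N K)
    (h1 : ∀ ⦃n : ℕ⦄, Squarefree n →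
      ∀ [(congruentNumberCurve n).IsElliptic] [ContinuousSMul ℤ_[2] ((congruentNumberCurve n).tateModule 2)]
        (κ : ZpExtension ℚ 2) (γ : absoluteGaloisGroup ℚ), κ.IsCyclotomic → κ.IsTopGenerator γ →
        ∀ I : IwasawaH1Data (congruentNumberCurve n) 2 κ γ,
          (congruentNumberCurve n).mordellWeilRank = 1 →
            Finite (AddCommGroup.primaryComponent (congruentNumberCurve n).sha 2) →
              1 ≤ Module.rank (IwasawaAlgebra 2) I.H)
    (hV : ∀ ⦃n : ℕ⦄, Squarefree n →
      ∀ [(congruentNumberCurve n).IsElliptic] [(congruentNumberCurve n).IsGloballyMinimal]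
        [ContinuousSMul ℤ_[2] ((congruentNumberCurve n).tateModule 2)]
        (K : Type) [Field K] [NumberField K] (N : ℕ) [NeZero N],
        (congruentNumberCurve n).conductorNorm ℤ = N → IsImaginaryQuadratic K →
          SatisfiesHeegnerHypothesis N K → SatisfiesHeegnerHypothesis 2 K →
            ((congruentNumberCurve n).quadraticTwist (NumberField.discr K : ℚ)).entireLFunction 1 ≠ 0 →
        ∀ (P : ((congruentNumberCurve n).baseChange K).toAffine.Point),
          IsHeegnerPoint N (congruentNumberCurve n) K P → IsOfFinAddOrder P →
            (congruentNumberCurve n).entireLFunction 1 = 0 →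
        ∀ (D : KatoDescentDatum 2) (pin : KatoDescentDatumPinH2 (congruentNumberCurve n) 2 D),
          (∃ a b : ℕ,
            Ideal.span {((2 : ℕ) : IwasawaAlgebra 2) ^ a} * Module.charIdeal (IwasawaAlgebra 2) D.H2 =
              Ideal.span {((2 : ℕ) : IwasawaAlgebra 2) ^ b} *
                Module.charIdeal (IwasawaAlgebra 2) (D.H ⧸ (IwasawaAlgebra 2) ∙ D.z)) →
          HasLocPKummerLog (congruentNumberCurve n) 2 pin.katoClass 0) :
    AnalyticRankOneOfRankOneFiniteShaTwo :=
  cruxB_of_logZero_of_readings_rankOne hpar hmod hHL hKato hHP hGZ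
    (readingRK_congruentNumberCurve_of_nontrivial_rankOne fun _ hsq _ _ κ γ hκ hγ I hrank hsha ↦
      (nontrivial_iwasawaH1_iff_one_le_rank hγ I).mpr (h1 hsq κ γ hκ hγ I hrank hsha))
    (reading31_of_nontrivial_rankOne fun _ hsq _ _ κ γ hκ hγ I hrank hsha ↦
      (nontrivial_iwasawaH1_iff_one_le_rank hγ I).mpr (h1 hsq κ γ hκ hγ I hrank hsha))
    (reading31b_two_of_fact locP_kernel_isTorsion_of_rankOne_holds) hV

end Summit.BirchSwinnertonDyer.BirchSwinnertonDyer.Theorems.CongruentShaFreeCutKatoZetaRoadLogZero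

end
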